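import Summits.QuantumFields.YangMills.Theses.FradkinShenkerFlow
import Summits.QuantumFields.YangMills.Theorems.FradkinShenkerFlowSusceptibilityToPoincareOrbitSliceSplit
import Literature.Probability.Moments.EfronSteinProofs

/-!
# Stub `stub_orbitEfronStein` of the line `orbit-slice-reduction` (crux `SusceptibilityToPoincare`)

Route `FradkinShenkerFlow` of `YangMills`, crux item `stmt-QuantumFields-9441`
(`Summit.QuantumFields.YangMills.Theses.FradkinShenkerFlow.SusceptibilityToPoincare`, FS ⇒ UP).
This file proves stub (2a) of the registered skeleton
`Cruxes/SusceptibilityToPoincare/Lines/orbit-slice-reduction.lean`: the **Efron–Stein reduction of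
the orbit variance to single-site rotations**. For the 4D torus of side `2S+1`, the Wilson measure
`μ = wilsonMeasure r.ρ β`, the product Haar probability measure `π = Haar^{⊗ sites}` of the gauge
group `G^Λ` and a bounded measurable `F`,

  `∫ Var_π(g ↦ F(U^g)) dμ(U) ≤ ½ Σ_x ∫∫ (F U − F(U^{k at x}))² dHaar(k) dμ(U)`,

where `U^{k at x} = gaugeTransform (update 1 x k) U` rotates the single site `x` by `k`. It is an
unconditional theorem for every compact group `G`, every real `β` and every `S`, with constant
exactly `½`.

## Proof

The statement is an identity-plus-inequality of abstract probability
(`OrbitES.integral_variance_orbit_le`): for a probability space `(Ω, μ)`, a measurable group `G`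
with a right-invariant probability measure `λ`, a finite index type `ι`, a jointly measurable action
`act : (ι → G) → Ω → Ω` of the product group with `act (g h) = act g ∘ act h` each of whose maps
leaves every integral against `μ` invariant, and a bounded measurable `F`:
* pointwise in `ω`, the tree's **Efron–Stein inequality**
  (`Literature.Probability.Moments.EfronSteinInequality_holds`, independent-copy form) for
  `f(g) = F(act g ω)` on the product probability space `(ι → G, λ^{⊗ι})` gives
  `Var_π f ≤ ½ Σ_i ∫∫ (f g − f (update g i k))² dλ(k) dπ(g)` (`OrbitES.variance_orbit_le`);
* the group identity `update g i k = update 1 i (k (g i)⁻¹) · g`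
  (`OrbitES.update_eq_update_one_mul`) and right invariance of `λ` (`integral_mul_right_eq_self`)
  turn the `i`-th inner integral into `Ψ_i(act g ω)` with
  `Ψ_i(ω') = ∫ (F ω' − F(act (update 1 i k) ω'))² dλ(k)`;
* integrating over `μ` (`integral_mono_of_nonneg`, the variance being nonnegative), Fubini on the
  product of two probability spaces and invariance of `μ` under each `act g`
  (`OrbitES.integral_integral_orbit_eq`) give `∫∫ Ψ_i(act g ω) dπ dμ = ∫ Ψ_i dμ`.
The lattice instance: `act g U = gaugeTransform g U` is jointly continuous
(`continuous_gaugeAction_univ`), hence measurable for second-countable `G` (second countability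
comes from the faithful representation `r`), multiplicative (`gaugeTransform_mul`), and `μ` is
gauge invariant (`integral_comp_gaugeTransform_wilsonMeasure`); `λ = haarProbability G` is right
invariant (compact groups are unimodular, `haarProbability.instIsMulRightInvariant`).
-/

noncomputable section

open MeasureTheory ProbabilityTheory
open Literature.MathematicalPhysics.QuantumFieldTheory

namespace Summit.QuantumFields.YangMills.Theorems.SusceptibilityToPoincare

/-! ### Abstract probability: Efron–Stein along the orbits of a product group action -/

namespace OrbitES

section Algebra

variable {ι : Type*} [DecidableEq ι] {G : Type*} [Group G]

/-- Updating one coordinate of `g : ι → G` is left multiplication by a single-site element: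
`update g i k = update 1 i (k (g i)⁻¹) · g`. [folklore] -/
theorem update_eq_update_one_mul (g : ι → G) (i : ι) (k : G) :
    Function.update g i k = Function.update (1 : ι → G) i (k * (g i)⁻¹) * g := by
  funext j
  rcases eq_or_ne j i with rfl | hj
  · simp
  · simp [hj]

/-- `‖(a − b)²‖ ≤ (2M)²` when `|a|, |b| ≤ M`. [folklore] -/
theorem norm_sq_sub_le {a b M : ℝ} (ha : |a| ≤ M) (hb : |b| ≤ M) :
    ‖(a - b) ^ 2‖ ≤ (2 * M) ^ 2 := by
  rw [norm_pow, Real.norm_eq_abs]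
  refine pow_le_pow_left₀ (abs_nonneg _) ?_ 2
  calc |a - b| ≤ |a| + |b| := abs_sub a b
    _ ≤ M + M := add_le_add ha hb
    _ = 2 * M := (two_mul M).symm

end Algebra

section Probability

variable {Ω : Type*} {ι : Type*} [Fintype ι] [DecidableEq ι]
  {G : Type*} [Group G] [MeasurableSpace G] [MeasurableMul G]

/-- **Efron–Stein along an orbit, pointwise.** For a right-invariant probability measure `λ` on a
measurable group `G`, an action `act` of the product group `ι → G` on `Ω` with
`act (g h) = act g ∘ act h`, a function `F` bounded by `M`, and a point `ω` whose orbit map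
`g ↦ F(act g ω)` is measurable:
`Var_{λ^{⊗ι}}(g ↦ F(act g ω)) ≤ ½ Σ_i ∫ (∫ (F(act g ω) − F(act (update 1 i k) (act g ω)))² dλ(k)) dλ^{⊗ι}(g)`
— the Efron–Stein inequality for `g ↦ F(act g ω)`, followed by `update g i k = update 1 i (k (g i)⁻¹) g`
and the substitution `k ↦ k (g i)` (right invariance). [folklore] -/
theorem variance_orbit_le (lam : Measure G) [IsProbabilityMeasure lam]
    [Measure.IsMulRightInvariant lam] {act : (ι → G) → Ω → Ω}
    (hmul : ∀ (g h : ι → G) (ω : Ω), act (g * h) ω = act g (act h ω)) {F : Ω → ℝ} {M : ℝ}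
    (hM : ∀ ω, |F ω| ≤ M) (ω : Ω) (hXm : Measurable fun g : ι → G => F (act g ω)) :
    variance (fun g : ι → G => F (act g ω)) (Measure.pi fun _ : ι => lam) ≤
      (1 / 2 : ℝ) * ∑ i, ∫ g, (∫ k, (F (act g ω) -
        F (act (Function.update (1 : ι → G) i k) (act g ω))) ^ 2 ∂lam)
        ∂(Measure.pi fun _ : ι => lam) := by
  have hmem : MemLp (fun g : ι → G => F (act g ω)) 2 (Measure.pi fun _ : ι => lam) :=
    MemLp.of_bound hXm.aestronglyMeasurable M
      (ae_of_all _ fun g => by simpa only [Real.norm_eq_abs] using hM (act g ω))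
  have hES := Literature.Probability.Moments.EfronSteinInequality_holds ι (fun _ => G)
    (fun _ => lam) (fun g => F (act g ω)) hXm hmem
  refine hES.trans_eq ?_
  congr 1
  refine Finset.sum_congr rfl fun i _ => integral_congr_ae (ae_of_all _ fun g => ?_)
  have h1 : ∀ k : G, act (Function.update g i k) ω =
      act (Function.update (1 : ι → G) i (k * (g i)⁻¹)) (act g ω) := fun k => by
    rw [update_eq_update_one_mul g i k, hmul]
  simp only [h1]
  exact integral_mul_right_eq_self (μ := lam)
    (fun k => (F (act g ω) - F (act (Function.update (1 : ι → G) i k) (act g ω))) ^ 2) (g i)⁻¹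

variable [MeasurableSpace Ω]

/-- **Fubini and invariance.** For probability spaces `(Ω, μ)`, `(K, π)`, a jointly measurable
`act : K → Ω → Ω` each of whose maps leaves all integrals against `μ` invariant, and a bounded
measurable `Φ`: `∫∫ Φ(act k ω) dπ(k) dμ(ω) = ∫ Φ dμ`. [folklore] -/
theorem integral_integral_orbit_eq {K : Type*} [MeasurableSpace K] {μ : Measure Ω}
    [IsProbabilityMeasure μ] {π : Measure K} [IsProbabilityMeasure π] {act : K → Ω → Ω}
    (hact : Measurable fun p : K × Ω => act p.1 p.2)
    (hinv : ∀ (k : K) (f : Ω → ℝ), ∫ ω, f (act k ω) ∂μ = ∫ ω, f ω ∂μ)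
    {Φ : Ω → ℝ} (hΦ : Measurable Φ) {B : ℝ} (hB : ∀ ω, ‖Φ ω‖ ≤ B) :
    ∫ ω, ∫ k, Φ (act k ω) ∂π ∂μ = ∫ ω, Φ ω ∂μ := by
  have hint : Integrable (Function.uncurry fun ω k => Φ (act k ω)) (μ.prod π) :=
    Integrable.of_bound ((hΦ.comp hact).comp measurable_swap).aestronglyMeasurable B
      (ae_of_all _ fun p => hB (act p.2 p.1))
  rw [integral_integral_swap hint]
  have h1 : ∀ k, ∫ ω, Φ (act k ω) ∂μ = ∫ ω, Φ ω ∂μ := fun k => hinv k Φ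
  simp only [h1, integral_const, probReal_univ, one_smul]

/-- **Efron–Stein reduction of the orbit variance to single-site rotations** (abstract form).
Let `(Ω, μ)` be a probability space, `λ` a right-invariant probability measure on a measurable
group `G`, `ι` a finite index type, `act` a jointly measurable action of the product group `ι → G`
on `Ω` with `act (g h) = act g ∘ act h` each of whose maps leaves all integrals against `μ`
invariant, and `F` measurable with `|F| ≤ M`. Then
`∫ Var_{λ^{⊗ι}}(g ↦ F(act g ω)) dμ(ω) ≤ ½ Σ_i ∫∫ (F ω − F(act (update 1 i k) ω))² dλ(k) dμ(ω)`:
Efron–Stein pointwise (`variance_orbit_le`), then Fubini and invariance of `μ`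
(`integral_integral_orbit_eq`). [folklore] -/
theorem integral_variance_orbit_le {μ : Measure Ω} [IsProbabilityMeasure μ] (lam : Measure G)
    [IsProbabilityMeasure lam] [Measure.IsMulRightInvariant lam] {act : (ι → G) → Ω → Ω}
    (hact : Measurable fun p : (ι → G) × Ω => act p.1 p.2)
    (hmul : ∀ (g h : ι → G) (ω : Ω), act (g * h) ω = act g (act h ω))
    (hinv : ∀ (g : ι → G) (f : Ω → ℝ), ∫ ω, f (act g ω) ∂μ = ∫ ω, f ω ∂μ)
    {F : Ω → ℝ} (hF : Measurable F) {M : ℝ} (hM : ∀ ω, |F ω| ≤ M) :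
    ∫ ω, variance (fun g : ι → G => F (act g ω)) (Measure.pi fun _ : ι => lam) ∂μ ≤
      (1 / 2 : ℝ) * ∑ i, ∫ ω, ∫ k,
        (F ω - F (act (Function.update (1 : ι → G) i k) ω)) ^ 2 ∂lam ∂μ := by
  -- joint measurability of the orbit map and of the single-site rotations
  have hFj : Measurable fun p : (ι → G) × Ω => F (act p.1 p.2) := hF.comp hact
  have hXm : ∀ ω, Measurable fun g : ι → G => F (act g ω) := fun ω =>
    hFj.comp measurable_prodMk_right
  have hupd : ∀ i, Measurable fun q : G × Ω => (Function.update (1 : ι → G) i q.1, q.2) :=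
    fun i => ((measurable_update (1 : ι → G)).comp measurable_fst).prodMk measurable_snd
  have hrot : ∀ i, Measurable fun q : G × Ω => act (Function.update (1 : ι → G) i q.1) q.2 :=
    fun i => hact.comp (hupd i)
  have hDm : ∀ i, Measurable fun q : G × Ω =>
      (F q.2 - F (act (Function.update (1 : ι → G) i q.1) q.2)) ^ 2 :=
    fun i => ((hF.comp measurable_snd).sub (hF.comp (hrot i))).pow_const 2
  -- the single-site cost `Ψ_i ω = ∫ (F ω − F(act (update 1 i k) ω))² dλ(k)`: measurable, bounded
  have hΨm : ∀ i, Measurable fun ω =>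
      ∫ k, (F ω - F (act (Function.update (1 : ι → G) i k) ω)) ^ 2 ∂lam :=
    fun i => ((hDm i).stronglyMeasurable.integral_prod_left' (μ := lam)).measurable
  have hΨb : ∀ i ω,
      ‖∫ k, (F ω - F (act (Function.update (1 : ι → G) i k) ω)) ^ 2 ∂lam‖ ≤ (2 * M) ^ 2 :=
    fun i ω => by
      have := norm_integral_le_of_norm_le_const (μ := lam) (C := (2 * M) ^ 2)
        (f := fun k => (F ω - F (act (Function.update (1 : ι → G) i k) ω)) ^ 2)
        (ae_of_all _ fun k => norm_sq_sub_le (hM _) (hM _))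
      simpa [probReal_univ] using this
  -- the orbit integral of `Ψ_i`: measurable and integrable in `ω`
  have hΦm : ∀ i, Measurable fun ω => ∫ g, (∫ k, (F (act g ω) -
      F (act (Function.update (1 : ι → G) i k) (act g ω))) ^ 2 ∂lam)
      ∂(Measure.pi fun _ : ι => lam) :=
    fun i => (((hΨm i).comp hact).stronglyMeasurable.integral_prod_left'
      (μ := Measure.pi fun _ : ι => lam)).measurable
  have hΦi : ∀ i, Integrable (fun ω => ∫ g, (∫ k, (F (act g ω) -
      F (act (Function.update (1 : ι → G) i k) (act g ω))) ^ 2 ∂lam)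
      ∂(Measure.pi fun _ : ι => lam)) μ :=
    fun i => Integrable.of_bound (hΦm i).aestronglyMeasurable ((2 * M) ^ 2)
      (ae_of_all _ fun ω => by
        have := norm_integral_le_of_norm_le_const (μ := Measure.pi fun _ : ι => lam)
          (C := (2 * M) ^ 2) (f := fun g => ∫ k, (F (act g ω) -
            F (act (Function.update (1 : ι → G) i k) (act g ω))) ^ 2 ∂lam)
          (ae_of_all _ fun g => hΨb i (act g ω))
        simpa [probReal_univ] using this)
  have hRi : Integrable (fun ω => (1 / 2 : ℝ) * ∑ i, ∫ g, (∫ k, (F (act g ω) -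
      F (act (Function.update (1 : ι → G) i k) (act g ω))) ^ 2 ∂lam)
      ∂(Measure.pi fun _ : ι => lam)) μ :=
    (integrable_finsetSum _ fun i _ => hΦi i).const_mul _
  calc ∫ ω, variance (fun g : ι → G => F (act g ω)) (Measure.pi fun _ : ι => lam) ∂μ
      ≤ ∫ ω, (1 / 2 : ℝ) * ∑ i, ∫ g, (∫ k, (F (act g ω) -
          F (act (Function.update (1 : ι → G) i k) (act g ω))) ^ 2 ∂lam)
          ∂(Measure.pi fun _ : ι => lam) ∂μ :=
        integral_mono_of_nonneg (ae_of_all _ fun ω => variance_nonneg _ _) hRi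
          (ae_of_all _ fun ω => variance_orbit_le lam hmul hM ω (hXm ω))
    _ = (1 / 2 : ℝ) * ∑ i, ∫ ω, ∫ g, (∫ k, (F (act g ω) -
          F (act (Function.update (1 : ι → G) i k) (act g ω))) ^ 2 ∂lam)
          ∂(Measure.pi fun _ : ι => lam) ∂μ := by
        rw [integral_const_mul, integral_finsetSum _ fun i _ => hΦi i]
    _ = (1 / 2 : ℝ) * ∑ i, ∫ ω, ∫ k,
          (F ω - F (act (Function.update (1 : ι → G) i k) ω)) ^ 2 ∂lam ∂μ := by
        congr 1
        refine Finset.sum_congr rfl fun i _ => ?_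
        exact integral_integral_orbit_eq hact hinv (hΨm i) (hΨb i)

end Probability

end OrbitES

/-! ### The registered stub -/

/-- `stub_orbitEfronStein` — **Efron–Stein on the gauge group** (stub (2a) of the line
`orbit-slice-reduction`). For every compact group `G` with a lattice representation `r`, every
real `β`, every side `2S+1` and every measurable `F` with `|F| ≤ M` on the configurations of the 4D
torus: `∫ Var_π(g ↦ F(U^g)) dμ(U) ≤ ½ Σ_x ∫∫ (F U − F(U^{k at x}))² dHaar(k) dμ(U)` for the Wilson
measure `μ = wilsonMeasure r.ρ β`, the product Haar probability measure `π = Haar^{⊗ sites}` and the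
single-site rotation `U^{k at x} = gaugeTransform (update 1 x k) U`. The Efron–Stein inequality
(`Literature.Probability.Moments.EfronSteinInequality_holds`) on the gauge group `G^{sites}`, the
identity `U^{update g x k} = (U^g)^{update 1 x (k g_x⁻¹)}`, right invariance of Haar, Fubini, and
gauge invariance of `μ` (`OrbitES.integral_variance_orbit_le`). [folklore] -/
theorem stub_orbitEfronStein :
    ∀ (G : Type) [Group G] [TopologicalSpace G] [IsTopologicalGroup G] [CompactSpace G]
      [MeasurableSpace G] [BorelSpace G] (r : LatticeRep G) (β : ℝ) (S : ℕ)
      (F : GaugeConfig 4 (2 * S + 1) G → ℝ), Measurable F → (∃ M : ℝ, ∀ U, |F U| ≤ M) →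
      ∫ U, variance (fun g : Site 4 (2 * S + 1) → G => F (gaugeTransform g U))
          (Measure.pi fun _ : Site 4 (2 * S + 1) => haarProbability G)
        ∂(wilsonMeasure r.ρ β : Measure (GaugeConfig 4 (2 * S + 1) G)) ≤
      (1 / 2 : ℝ) * ∑ x : Site 4 (2 * S + 1), ∫ U, ∫ k,
          (F U - F (gaugeTransform (Function.update (1 : Site 4 (2 * S + 1) → G) x k) U)) ^ 2
        ∂(haarProbability G) ∂(wilsonMeasure r.ρ β : Measure (GaugeConfig 4 (2 * S + 1) G)) := by
  intro G _ _ _ _ _ _ r β S F hF hbd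
  obtain ⟨M, hM⟩ := hbd
  haveI : SecondCountableTopology G :=
    (r.continuous.isClosedEmbedding r.injective).isEmbedding.secondCountableTopology
  haveI : IsProbabilityMeasure (wilsonMeasure (d := 4) (L := 2 * S + 1) r.ρ β) :=
    isProbabilityMeasure_wilsonMeasure (d := 4) (L := 2 * S + 1) r.ρ r.continuous β
  have hact : Measurable fun p : (Site 4 (2 * S + 1) → G) × GaugeConfig 4 (2 * S + 1) G =>
      gaugeTransform p.1 p.2 :=
    (continuous_gaugeAction_univ (d := 4) (L := 2 * S + 1) (G := G)).measurable
  have hmul : ∀ (g h : Site 4 (2 * S + 1) → G) (U : GaugeConfig 4 (2 * S + 1) G),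
      gaugeTransform (g * h) U = gaugeTransform g (gaugeTransform h U) := fun g h U =>
    gaugeTransform_mul g h U
  have hinv : ∀ (g : Site 4 (2 * S + 1) → G) (f : GaugeConfig 4 (2 * S + 1) G → ℝ),
      ∫ U, f (gaugeTransform g U) ∂(wilsonMeasure (d := 4) (L := 2 * S + 1) r.ρ β) =
        ∫ U, f U ∂(wilsonMeasure (d := 4) (L := 2 * S + 1) r.ρ β) := fun g f =>
    integral_comp_gaugeTransform_wilsonMeasure r.ρ β g f
  exact OrbitES.integral_variance_orbit_le (haarProbability G) hact hmul hinv hF hM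

end Summit.QuantumFields.YangMills.Theorems.SusceptibilityToPoincare

end
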